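import Literature.Analysis.FunctionSpaces.PoincareWirtingerConvex
import Mathlib.MeasureTheory.Function.LpSeminorm.CompareExp
import Mathlib.MeasureTheory.Function.LpSeminorm.TriangleInequality
import Mathlib.Analysis.InnerProductSpace.PiL2
import Mathlib.MeasureTheory.Integral.Average
import Mathlib.MeasureTheory.Measure.Haar.InnerProductSpace
import Mathlib.MeasureTheory.Measure.Lebesgue.EqHaar
import HarnessLib

/-!
# Crux `BlockLipschitzL` (stmt-QuantumFields-23533) ∕ `HistoryTailL` (stmt-QuantumFields-19936), LINE 25 «CompactnessTransfer»,
# the (TM) discharge ROAD (H), brick (H) — file H2 «PLANAR STREAM FUNCTION: THE POINCARÉ–WIRTINGER `L¹` ESTIMATE ON BALLS»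

Cell `ym3-torus` (YM ladder rung R3 = continuum SU(2) Yang–Mills on T³ — a RUNG, NOT Clay); WIDTH helper seat `ym3-torus-px5` g9;
`--supports stmt-QuantumFields-23533`; THEOREMS ONLY (0 `def`, 0 `sorry`, default heartbeats); imports lit
✓`Literature.Analysis.FunctionSpaces.PoincareWirtingerConvex` (`∫_Q ‖G − ⨍_Q G‖² ≤ 2ⁿ D² ∫_Q ‖DG‖²`) + Mathlib.

WHAT THIS FILE DOES (`E² = EuclideanSpace ℝ (Fin 2)`): ★★ `eLpNorm_one_ball_le` — for a `C¹` function `G : E² → ℝ` NORMALISED by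
`∫_{B₁(0)} G = 0` and every radius `R ≥ 1`,
`‖G‖_{L¹(B_R(0))} ≤ K_R · ‖DG‖_{L²(E²)}`, `K_R = (1 + |B_R|∕|B₁|)·|B_R|^{1∕2}·4R`
(Poincaré–Wirtinger on the convex ball `B_R` + Cauchy–Schwarz + the normalisation, which controls the mean on `B_R` by the mean-zero
condition on `B₁ ⊆ B_R`).  This is the Cauchy estimate that makes the normalised potentials of the mollified fields converge in
`L¹_loc` in files H3∕H4.  Everything is stated in `ℝ≥0∞` (`eLpNorm`), so no integrability bookkeeping is needed downstream.
HONEST SCOPE.  A measure-theoretic letter; nothing of (TM), (ZD), (C), S1″, K1, `MeanDeviationL`, `BlockLipschitzL`, `HistoryTailL` is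
proved here.  YM₃ on T³ is rung R3, not Clay; YM gap NOT proved; no summit statement is proved here.

References: L. C. Evans, Partial Differential Equations, 2nd ed. (2010), §5.8.1 Thm. 1 (Poincaré's inequality on balls) [Evans2010].
-/

set_option autoImplicit false

noncomputable section

open scoped BigOperators Topology ENNReal NNReal
open MeasureTheory Set Filter Function TopologicalSpace Metric

namespace Summit.QuantumFields.YangMills.Theorems.PoincareLipschitzPlanarStreamFunctionCauchy

open Literature.Analysis.FunctionSpaces (lintegral_enorm_sub_setAverage_sq_le)

/-! ## The Poincaré–Wirtinger `L¹` estimate on balls for normalised `C¹` functions -/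

/-- `L¹ ≤ |B_R|^{1∕2} · L²` on the ball (Cauchy–Schwarz). [folklore] -/
theorem eLpNorm_one_le_sqrt_measure_mul_eLpNorm_two {f : EuclideanSpace ℝ (Fin 2) → ℝ}
    (hf : AEStronglyMeasurable f volume) (R : ℝ) :
    eLpNorm f 1 (volume.restrict (ball (0 : EuclideanSpace ℝ (Fin 2)) R)) ≤
      eLpNorm f 2 (volume.restrict (ball (0 : EuclideanSpace ℝ (Fin 2)) R)) *
        volume (ball (0 : EuclideanSpace ℝ (Fin 2)) R) ^ (1 / 2 : ℝ) := by
  have h := eLpNorm_le_eLpNorm_mul_rpow_measure_univ (μ := volume.restrict (ball (0 : EuclideanSpace ℝ (Fin 2)) R))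
    (p := 1) (q := 2) (by norm_num) hf.restrict
  rw [Measure.restrict_apply_univ] at h
  have hexp : (1 / (1 : ℝ≥0∞).toReal - 1 / (2 : ℝ≥0∞).toReal : ℝ) = 1 / 2 := by
    rw [ENNReal.toReal_one, ENNReal.toReal_ofNat]; norm_num
  rw [hexp] at h
  exact h

/-- ★★ **THE `L¹` ESTIMATE ON BALLS FOR NORMALISED `C¹` FUNCTIONS.**  Let `G : E² → ℝ` be `C¹` with `∫_{B₁(0)} G = 0` and let `R ≥ 1`.
Then `‖G‖_{L¹(B_R)} ≤ (1 + |B_R|·|B₁|⁻¹)·|B_R|^{1∕2}·4R·‖DG‖_{L²(E²)}`.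
Proof: with `c = ⨍_{B_R} G`, Poincaré–Wirtinger on the convex ball (`diam ≤ 2R`, `n = 2`) gives `‖G − c‖_{L²(B_R)} ≤ 4R‖DG‖_{L²}`;
Cauchy–Schwarz gives the `L¹(B_R)` bound `X`; the normalisation gives `|c|·|B₁| = |∫_{B₁}(G − c)| ≤ X`. [cite: Evans2010, §5.8.1 Thm. 1] -/
theorem eLpNorm_one_ball_le {G : EuclideanSpace ℝ (Fin 2) → ℝ} (hG : ContDiff ℝ 1 G)
    (h0 : ∫ y in ball (0 : EuclideanSpace ℝ (Fin 2)) 1, G y = 0) {R : ℝ} (hR : 1 ≤ R) :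
    eLpNorm G 1 (volume.restrict (ball (0 : EuclideanSpace ℝ (Fin 2)) R)) ≤
      (1 + volume (ball (0 : EuclideanSpace ℝ (Fin 2)) R) * (volume (ball (0 : EuclideanSpace ℝ (Fin 2)) 1))⁻¹) *
        volume (ball (0 : EuclideanSpace ℝ (Fin 2)) R) ^ (1 / 2 : ℝ) * ENNReal.ofReal (4 * R) *
          eLpNorm (fderiv ℝ G) 2 volume := by
  -- notation-free abbreviations
  set BR : Set (EuclideanSpace ℝ (Fin 2)) := ball 0 R with hBR
  set B1 : Set (EuclideanSpace ℝ (Fin 2)) := ball 0 1 with hB1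
  set μR : Measure (EuclideanSpace ℝ (Fin 2)) := volume.restrict BR with hμR
  have hR0 : 0 < R := lt_of_lt_of_le one_pos hR
  have hB1R : B1 ⊆ BR := ball_subset_ball hR
  have hvR0 : volume BR ≠ 0 := (measure_ball_pos volume (0 : EuclideanSpace ℝ (Fin 2)) hR0).ne'
  have hvRt : volume BR ≠ ∞ := measure_ball_lt_top.ne
  have hv10 : volume B1 ≠ 0 := (measure_ball_pos volume (0 : EuclideanSpace ℝ (Fin 2)) one_pos).ne'
  have hv1t : volume B1 ≠ ∞ := measure_ball_lt_top.ne
  have hGc : Continuous G := hG.continuous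
  have hGm : AEStronglyMeasurable G volume := hGc.aestronglyMeasurable
  have hGi : IntegrableOn G BR volume :=
    (hGc.continuousOn.integrableOn_compact (isCompact_closedBall (0 : EuclideanSpace ℝ (Fin 2)) R)).mono_set
      ball_subset_closedBall
  set c : ℝ := ⨍ y in BR, G y with hc
  -- Step 1: Poincaré–Wirtinger in `L²(B_R)`
  have hPW : eLpNorm (fun y => G y - c) 2 μR ≤ ENNReal.ofReal (4 * R) * eLpNorm (fderiv ℝ G) 2 volume := by
    have hD : ∀ y ∈ BR, ∀ z ∈ BR, ‖y - z‖ ≤ 2 * R := by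
      intro y hy z hz
      rw [hBR, mem_ball_zero_iff] at hy hz
      calc ‖y - z‖ ≤ ‖y‖ + ‖z‖ := norm_sub_le y z
        _ ≤ 2 * R := by linarith
    have h := lintegral_enorm_sub_setAverage_sq_le (μ := volume) hG (convex_ball (0 : EuclideanSpace ℝ (Fin 2)) R)
      measurableSet_ball hvR0 hvRt hGi hD
    rw [finrank_euclideanSpace_fin] at h
    -- `2² (2R)² = (4R)²`
    have hconst : ENNReal.ofReal ((2:ℝ) ^ 2 * (2 * R) ^ 2) = ENNReal.ofReal (4 * R) ^ 2 := by
      rw [← ENNReal.ofReal_pow (by positivity)]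
      congr 1; ring
    rw [hconst] at h
    -- `‖f‖_{L²} = (∫ ‖f‖ₑ²)^{1/2}` (natural-number square inside) and `(a²)^{1/2} = a`
    have h2a : eLpNorm (fun y => G y - c) 2 μR = (∫⁻ y, ‖G y - c‖ₑ ^ 2 ∂μR) ^ (1 / 2 : ℝ) := by
      rw [eLpNorm_eq_lintegral_rpow_enorm_toReal two_ne_zero ENNReal.ofNat_ne_top, ENNReal.toReal_ofNat]
      congr 1
      refine lintegral_congr fun x => ?_
      rw [ENNReal.rpow_two]
    have h2b : eLpNorm (fderiv ℝ G) 2 volume = (∫⁻ y, ‖fderiv ℝ G y‖ₑ ^ 2) ^ (1 / 2 : ℝ) := by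
      rw [eLpNorm_eq_lintegral_rpow_enorm_toReal two_ne_zero ENNReal.ofNat_ne_top, ENNReal.toReal_ofNat]
      congr 1
      refine lintegral_congr fun x => ?_
      rw [ENNReal.rpow_two]
    have hsqrt : ∀ a : ℝ≥0∞, (a ^ 2) ^ (1 / 2 : ℝ) = a := by
      intro a
      have h12 : (1 / 2 : ℝ) = ((2 : ℕ) : ℝ)⁻¹ := by norm_num
      rw [h12]
      exact ENNReal.pow_rpow_inv_natCast two_ne_zero a
    rw [h2a, h2b, hμR]
    calc (∫⁻ y in BR, ‖G y - c‖ₑ ^ 2) ^ (1 / 2 : ℝ)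
        ≤ (ENNReal.ofReal (4 * R) ^ 2 * ∫⁻ y in BR, ‖fderiv ℝ G y‖ₑ ^ 2) ^ (1 / 2 : ℝ) :=
          ENNReal.rpow_le_rpow h (by norm_num)
      _ ≤ (ENNReal.ofReal (4 * R) ^ 2 * ∫⁻ y, ‖fderiv ℝ G y‖ₑ ^ 2) ^ (1 / 2 : ℝ) := by
          gcongr
          exact Measure.restrict_le_self
      _ = ENNReal.ofReal (4 * R) * (∫⁻ y, ‖fderiv ℝ G y‖ₑ ^ 2) ^ (1 / 2 : ℝ) := by
          rw [ENNReal.mul_rpow_of_nonneg _ _ (by norm_num), hsqrt]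
  -- Step 2: Cauchy–Schwarz, `X := ‖G − c‖_{L¹(B_R)} ≤ |B_R|^{1/2}·4R·‖DG‖_{L²}`
  have hGcm : AEStronglyMeasurable (fun y => G y - c) volume := (hGc.sub continuous_const).aestronglyMeasurable
  set X : ℝ≥0∞ := eLpNorm (fun y => G y - c) 1 μR with hX
  have hXle : X ≤ volume BR ^ (1 / 2 : ℝ) * ENNReal.ofReal (4 * R) * eLpNorm (fderiv ℝ G) 2 volume := by
    calc X ≤ eLpNorm (fun y => G y - c) 2 μR * volume BR ^ (1 / 2 : ℝ) :=
          eLpNorm_one_le_sqrt_measure_mul_eLpNorm_two hGcm R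
      _ ≤ (ENNReal.ofReal (4 * R) * eLpNorm (fderiv ℝ G) 2 volume) * volume BR ^ (1 / 2 : ℝ) := by gcongr
      _ = volume BR ^ (1 / 2 : ℝ) * ENNReal.ofReal (4 * R) * eLpNorm (fderiv ℝ G) 2 volume := by ring
  -- Step 3: the mean `c` is controlled by the normalisation on `B₁ ⊆ B_R`: `‖c‖ₑ · |B₁| ≤ X`
  have hcB1 : ‖c‖ₑ * volume B1 ≤ X := by
    -- `∫_{B₁} (G − c) = −c·|B₁|`
    have hint : ∫ y in B1, (G y - c) = -(c * (volume B1).toReal) := by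
      rw [integral_sub (hGi.mono_set hB1R) (integrableOn_const hv1t), h0, setIntegral_const, smul_eq_mul,
        Measure.real]
      ring
    have h1 : ‖∫ y in B1, (G y - c)‖ₑ = ‖c‖ₑ * volume B1 := by
      rw [hint, enorm_neg, enorm_mul, Real.enorm_eq_ofReal ENNReal.toReal_nonneg, ENNReal.ofReal_toReal hv1t]
    rw [← h1]
    calc ‖∫ y in B1, (G y - c)‖ₑ ≤ ∫⁻ y in B1, ‖G y - c‖ₑ := enorm_integral_le_lintegral_enorm _
      _ ≤ ∫⁻ y in BR, ‖G y - c‖ₑ := lintegral_mono_set hB1R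
      _ = X := by rw [hX, hμR, eLpNorm_one_eq_lintegral_enorm]
  have hc : ‖c‖ₑ ≤ X / volume B1 := (ENNReal.le_div_iff_mul_le (Or.inl hv10) (Or.inl hv1t)).2 hcB1
  -- Step 4: triangle inequality `‖G‖ ≤ ‖G − c‖ + ‖c‖`
  have hconst : eLpNorm (fun _ : EuclideanSpace ℝ (Fin 2) => c) 1 μR = ‖c‖ₑ * volume BR := by
    rw [eLpNorm_const' c one_ne_zero ENNReal.one_ne_top, hμR, Measure.restrict_apply_univ, ENNReal.toReal_one, div_one,
      ENNReal.rpow_one]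
  have hsplit : eLpNorm G 1 μR ≤ X + ‖c‖ₑ * volume BR := by
    have hdecomp : G = (fun y => G y - c) + fun _ => c := by funext y; simp
    calc eLpNorm G 1 μR = eLpNorm ((fun y => G y - c) + fun _ => c) 1 μR := by rw [← hdecomp]
      _ ≤ eLpNorm (fun y => G y - c) 1 μR + eLpNorm (fun _ : EuclideanSpace ℝ (Fin 2) => c) 1 μR :=
          eLpNorm_add_le hGcm.restrict aestronglyMeasurable_const le_rfl
      _ = X + ‖c‖ₑ * volume BR := by rw [hX, hconst]
  -- Step 5: assemble
  calc eLpNorm G 1 μR ≤ X + ‖c‖ₑ * volume BR := hsplit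
    _ ≤ X + X / volume B1 * volume BR := by gcongr
    _ = (1 + volume BR * (volume B1)⁻¹) * X := by rw [div_eq_mul_inv]; ring
    _ ≤ (1 + volume BR * (volume B1)⁻¹) * (volume BR ^ (1 / 2 : ℝ) * ENNReal.ofReal (4 * R) * eLpNorm (fderiv ℝ G) 2 volume) := by
        gcongr
    _ = (1 + volume BR * (volume B1)⁻¹) * volume BR ^ (1 / 2 : ℝ) * ENNReal.ofReal (4 * R) *
          eLpNorm (fderiv ℝ G) 2 volume := by ring

end Summit.QuantumFields.YangMills.Theorems.PoincareLipschitzPlanarStreamFunctionCauchy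

end
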